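import Mathlib.Analysis.Distribution.TemperateGrowth
import Mathlib.Analysis.Calculus.BumpFunction.InnerProduct
import Mathlib.Analysis.SpecialFunctions.Sqrt
import Literature.Analysis.FluidPDE.CompressibleEulerProfileDerivativeDecay
import HarnessLib

/-!
# The self-similar profile fields have temperate growth (theorems only)

Topic `Literature/Analysis/FluidPDE`; namespace `Literature.Analysis.FluidPDE.CaolaboraEtAl2025`.
Sequel of `CompressibleEulerProfileDerivativeDecay.lean` (all radial derivatives of the profile
of the vendored fact `BuckmasterCaolaboraGomezserrano2025_thm11_monatomic` decay like `ζ^{1−k}`).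
THEOREMS ONLY, no new facts (D-0026).

From the radial bounds to the fields on `ℝ³`: the profile fields `S̄(y) = S(|y|)` and
`Ū(y) = U(|y|) y/|y|` are smooth functions all of whose derivatives grow at most polynomially —
Mathlib's `Function.HasTemperateGrowth` — which is the form in which the far-field asymptotics
(1.6) of Cao-Labora–Gómez-Serrano–Shi–Staffilani (`|∇ʲŪ| + |∇ʲS̄| ≲ ⟨ζ⟩^{1−r−j}`, p. 6) enter
the polynomial-in-`(T−t)⁻¹` bounds on all derivatives of the exact self-similar solution
(clause 3 of the named fact `CaolaboraEtAl2025_thm12_rates`):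

* `exists_bound_iteratedDeriv_logProfile`: all derivatives of `(U(e^ξ)/e^ξ, S(e^ξ)/e^ξ)` are
  bounded for `ξ` large (the orbit of the autonomous system near `P_∞`, exported from the proof
  of `iteratedDeriv_profile_le`);
* `iteratedDeriv_le_of_rpow_mul_log`: `Ψ(s) = s^c h(b log s)` with all derivatives of `h`
  bounded has `|Ψ^{(k)}(s)| ≤ C s^{c−k}`; hence (`iteratedDeriv_profile_sqrt_le`) the functions
  `s ↦ S(√s)` and `s ↦ U(√s)/√s` — through which the fields factor over `y ↦ |y|²` — have
  derivatives `O(s^{1/2−k})`, `O(s^{−k})`;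
* `hasTemperateGrowth_of_iteratedDeriv_le`: such one-variable bounds on a half-line are the
  hypothesis of Mathlib's `Function.HasTemperateGrowth.comp'`;
* `hasTemperateGrowth_radialScalar`, `hasTemperateGrowth_radialField`: `S̄` and `Ū` have
  temperate growth (near the origin by smoothness and a bump-function cut-off, far away by
  composition with the temperate map `y ↦ |y|² + M χ(y)`).

[cite: CaolaboraEtAl2025, eq. (1.6) p. 6] [cite: BuckmasterCaolaboraGomezserrano2025, Thm 1.1 p. 4]
-/

noncomputable section

open Set Filter Topology Metric
open scoped ContDiff

namespace Literature.Analysis.FluidPDE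

open Literature.MathematicalPhysics.KineticTheory (V3)

namespace CaolaboraEtAl2025

/-! ### The orbit near `P_∞`: bounded derivatives in the logarithmic variable -/

section LogOrbit

variable {r : ℝ} {U S : ℝ → ℝ}

/-- **All derivatives of `(U(e^ξ)/e^ξ, S(e^ξ)/e^ξ)` are bounded for large `ξ`** (the orbit of
the autonomous profile system converges to the equilibrium `P_∞ = (0, 0)`, near which the system
is smooth). [cite: BuckmasterCaolaboraGomezserrano2025, Thm 1.1 p. 4 (`P_∞`)]
[cite: CaolaboraEtAl2025, §1.3 p. 5, profile equations] -/
theorem exists_bound_iteratedDeriv_logProfile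
    (hU : ContDiff ℝ ∞ fun y : V3 => (U ‖y‖ / ‖y‖) • y) (hS : ContDiff ℝ ∞ fun y : V3 => S ‖y‖)
    (hode : ∀ ζ : ℝ, 0 < ζ →
      (r - 1) * U ζ + (ζ + U ζ) * deriv U ζ + 1 / 3 * S ζ * deriv S ζ = 0 ∧
      (r - 1) * S ζ + (ζ + U ζ) * deriv S ζ + 1 / 3 * S ζ * (deriv U ζ + 2 * U ζ / ζ) = 0)
    (hlimU : Tendsto (fun ζ => U ζ / ζ) atTop (𝓝 0))
    (hlimS : Tendsto (fun ζ => S ζ / ζ) atTop (𝓝 0)) :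
    ∃ a : ℝ, ∀ m : ℕ, ∃ C, ∀ ξ, a < ξ →
      |iteratedDeriv m (fun ξ => Real.exp (-ξ) * U (Real.exp ξ)) ξ| ≤ C ∧
        |iteratedDeriv m (fun ξ => Real.exp (-ξ) * S (Real.exp ξ)) ξ| ≤ C := by
  have hUc : ∀ ζ : ℝ, 0 < ζ → ContDiffAt ℝ ∞ U ζ := fun ζ hζ => contDiffAt_profile_of_radialField hU hζ
  have hSc : ∀ ζ : ℝ, 0 < ζ → ContDiffAt ℝ ∞ S ζ := fun ζ hζ => contDiffAt_profile_of_radialScalar hS hζ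
  set 𝒰 : ℝ → ℝ := fun ξ => Real.exp (-ξ) * U (Real.exp ξ) with h𝒰
  set 𝒮 : ℝ → ℝ := fun ξ => Real.exp (-ξ) * S (Real.exp ξ) with h𝒮
  have h𝒰s : ContDiff ℝ ∞ 𝒰 := contDiff_logProfile hUc
  have h𝒮s : ContDiff ℝ ∞ 𝒮 := contDiff_logProfile hSc
  have hU𝒰 : ∀ ξ, U (Real.exp ξ) = Real.exp ξ * 𝒰 ξ := fun ξ => by
    simp only [h𝒰, Real.exp_neg]
    field_simp
  have hS𝒮 : ∀ ξ, S (Real.exp ξ) = Real.exp ξ * 𝒮 ξ := fun ξ => by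
    simp only [h𝒮, Real.exp_neg]
    field_simp
  have hl𝒰 : Tendsto 𝒰 atTop (𝓝 0) := by
    refine (hlimU.comp Real.tendsto_exp_atTop).congr fun ξ => ?_
    simp only [Function.comp_apply, h𝒰, Real.exp_neg, div_eq_inv_mul]
  have hl𝒮 : Tendsto 𝒮 atTop (𝓝 0) := by
    refine (hlimS.comp Real.tendsto_exp_atTop).congr fun ξ => ?_
    simp only [Function.comp_apply, h𝒮, Real.exp_neg, div_eq_inv_mul]
  obtain ⟨a, ha⟩ : ∃ a, ∀ ξ, a ≤ ξ → |𝒰 ξ| < 1 / 4 ∧ |𝒮 ξ| < 1 / 4 := by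
    have e1 := Metric.tendsto_nhds.1 hl𝒰 (1 / 4) (by norm_num)
    have e2 := Metric.tendsto_nhds.1 hl𝒮 (1 / 4) (by norm_num)
    obtain ⟨a, ha⟩ := eventually_atTop.1 (e1.and e2)
    exact ⟨a, fun ξ hξ => by simpa [Real.dist_eq] using ha ξ hξ⟩
  set W : ℝ × ℝ → ℝ × ℝ := fun w =>
    (((1 + w.1) * (-(r - 1) * w.1 - (1 + w.1) * w.1 - w.2 ^ 2 / 3) -
        w.2 / 3 * (-(r - 1) * w.2 - (1 + w.1) * w.2 - w.2 * w.1)) /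
        ((1 + w.1) ^ 2 - (w.2 / 3) ^ 2),
      ((1 + w.1) * (-(r - 1) * w.2 - (1 + w.1) * w.2 - w.2 * w.1) -
        w.2 / 3 * (-(r - 1) * w.1 - (1 + w.1) * w.1 - w.2 ^ 2 / 3)) /
        ((1 + w.1) ^ 2 - (w.2 / 3) ^ 2)) with hWdef
  set O : Set (ℝ × ℝ) := {w | (1 + w.1) ^ 2 - (w.2 / 3) ^ 2 ≠ 0} with hO
  have hOo : IsOpen O := isOpen_ne_fun (by fun_prop) continuous_const
  have hWs : ContDiffOn ℝ ∞ W O := by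
    have hΔ : ContDiffOn ℝ ∞ (fun w : ℝ × ℝ => (1 + w.1) ^ 2 - (w.2 / 3) ^ 2) O := by fun_prop
    have hn1 : ContDiffOn ℝ ∞ (fun w : ℝ × ℝ =>
        (1 + w.1) * (-(r - 1) * w.1 - (1 + w.1) * w.1 - w.2 ^ 2 / 3) -
          w.2 / 3 * (-(r - 1) * w.2 - (1 + w.1) * w.2 - w.2 * w.1)) O := by fun_prop
    have hn2 : ContDiffOn ℝ ∞ (fun w : ℝ × ℝ =>
        (1 + w.1) * (-(r - 1) * w.2 - (1 + w.1) * w.2 - w.2 * w.1) -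
          w.2 / 3 * (-(r - 1) * w.1 - (1 + w.1) * w.1 - w.2 ^ 2 / 3)) O := by fun_prop
    exact (hn1.div hΔ fun w hw => hw).prodMk (hn2.div hΔ fun w hw => hw)
  set K : Set (ℝ × ℝ) := Metric.closedBall 0 (1 / 4) with hK
  have hKc : IsCompact K := isCompact_closedBall _ _
  have hKO : K ⊆ O := by
    intro w hw
    have hw' : ‖w‖ ≤ 1 / 4 := by simpa [hK] using hw
    have h1 : |w.1| ≤ 1 / 4 := (norm_fst_le w).trans hw'
    have h2 : |w.2| ≤ 1 / 4 := (norm_snd_le w).trans hw'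
    rw [abs_le] at h1 h2
    show (1 + w.1) ^ 2 - (w.2 / 3) ^ 2 ≠ 0
    nlinarith
  set y : ℝ → ℝ × ℝ := fun ξ => (𝒰 ξ, 𝒮 ξ) with hy
  have hyK : ∀ ξ, a < ξ → y ξ ∈ K := by
    intro ξ hξ
    have h := ha ξ hξ.le
    simp only [hK, Metric.mem_closedBall, dist_zero_right, Prod.norm_def, hy, Real.norm_eq_abs]
    exact max_le h.1.le h.2.le
  have hyO : ∀ ξ, a < ξ → y ξ ∈ O := fun ξ hξ => hKO (hyK ξ hξ)
  have hode' : ∀ ξ, a < ξ → HasDerivAt y (W (y ξ)) ξ := by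
    intro ξ hξ
    have hΔ : (1 + 𝒰 ξ) ^ 2 - (𝒮 ξ / 3) ^ 2 ≠ 0 := hyO ξ hξ
    have d𝒰 := hasDerivAt_logProfile hUc ξ
    have d𝒮 := hasDerivAt_logProfile hSc ξ
    set p : ℝ := -(Real.exp (-ξ) * U (Real.exp ξ)) + deriv U (Real.exp ξ) with hp
    set q : ℝ := -(Real.exp (-ξ) * S (Real.exp ξ)) + deriv S (Real.exp ξ) with hq
    have hUp : deriv U (Real.exp ξ) = 𝒰 ξ + p := by simp only [hp, h𝒰]; ring
    have hSq : deriv S (Real.exp ξ) = 𝒮 ξ + q := by simp only [hq, h𝒮]; ring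
    have hζ := Real.exp_pos ξ
    obtain ⟨E1, E2⟩ := hode _ hζ
    rw [hU𝒰, hS𝒮, hUp, hSq] at E1 E2
    have hdiv : 2 * (Real.exp ξ * 𝒰 ξ) / Real.exp ξ = 2 * 𝒰 ξ := by field_simp
    rw [hdiv] at E2
    have L1 : (r - 1) * 𝒰 ξ + (1 + 𝒰 ξ) * (𝒰 ξ + p) + 1 / 3 * 𝒮 ξ * (𝒮 ξ + q) = 0 := by
      have h0 : Real.exp ξ * ((r - 1) * 𝒰 ξ + (1 + 𝒰 ξ) * (𝒰 ξ + p) +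
          1 / 3 * 𝒮 ξ * (𝒮 ξ + q)) = 0 := by rw [← E1]; ring
      exact (mul_eq_zero.1 h0).resolve_left hζ.ne'
    have L2 : (r - 1) * 𝒮 ξ + (1 + 𝒰 ξ) * (𝒮 ξ + q) +
        1 / 3 * 𝒮 ξ * (𝒰 ξ + p + 2 * 𝒰 ξ) = 0 := by
      have h0 : Real.exp ξ * ((r - 1) * 𝒮 ξ + (1 + 𝒰 ξ) * (𝒮 ξ + q) +
          1 / 3 * 𝒮 ξ * (𝒰 ξ + p + 2 * 𝒰 ξ)) = 0 := by rw [← E2]; ring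
      exact (mul_eq_zero.1 h0).resolve_left hζ.ne'
    obtain ⟨hp', hq'⟩ := logVar_solve L1 L2 hΔ
    have hW : W (y ξ) = (p, q) := by
      simp only [hWdef, hy]
      rw [hp', hq']
    rw [hW]
    exact d𝒰.prodMk d𝒮
  refine ⟨a, fun m => ?_⟩
  obtain ⟨C, hC⟩ := exists_bound_iteratedDeriv_of_flow hOo hWs hKc hKO hode' hyK m
  refine ⟨C, fun ξ hξ => ?_⟩
  have h := hC ξ hξ
  rw [hy, iteratedDeriv_prodMk h𝒰s h𝒮s m] at h
  simp only [Prod.norm_def, Real.norm_eq_abs, max_le_iff] at h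
  exact h

end LogOrbit

/-! ### Functions `s ↦ s^c h(b log s)` with `h` of bounded derivatives -/

section RpowLog

/-- If `Ψ(s) = s^c h(b log s)` for `s > s₀ > 0`, `b > 0`, with `h` smooth and all its derivatives
bounded on `(a, ∞)`, `a ≤ b log s₀`, then `|Ψ^{(k)}(s)| ≤ C_k s^{c−k}` for `s > s₀`: indeed
`Ψ^{(k)}(s) = s^{c−k} h_k(b log s)` with `h₀ = h`, `h_{k+1} = b h_k′ + (c−k) h_k`. [folklore] -/
theorem iteratedDeriv_le_of_rpow_mul_log {Ψ h : ℝ → ℝ} {a b c s₀ : ℝ} (hb : 0 < b)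
    (hh : ContDiff ℝ ∞ h) (hbd : ∀ m : ℕ, ∃ C, ∀ η, a < η → |iteratedDeriv m h η| ≤ C)
    (hs₀ : 0 < s₀) (has : a ≤ b * Real.log s₀)
    (hΨ : ∀ s, s₀ < s → Ψ s = s ^ c * h (b * Real.log s)) (k : ℕ) :
    ∃ C, ∀ s, s₀ < s → |iteratedDeriv k Ψ s| ≤ C * s ^ (c - k) := by
  have hlog : ∀ s, s₀ < s → a < b * Real.log s := fun s hs =>
    has.trans_lt (mul_lt_mul_of_pos_left (Real.log_lt_log hs₀ hs) hb)
  have key : ∀ k : ℕ, ∃ g : ℝ → ℝ, ContDiff ℝ ∞ g ∧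
      (∀ m : ℕ, ∃ C, ∀ η, a < η → |iteratedDeriv m g η| ≤ C) ∧
      ∀ s, s₀ < s → iteratedDeriv k Ψ s = s ^ (c - k) * g (b * Real.log s) := by
    intro k
    induction k with
    | zero => exact ⟨h, hh, hbd, fun s hs => by simpa using hΨ s hs⟩
    | succ k ih =>
      obtain ⟨g, hg, hgb, hfo⟩ := ih
      have hg' : ContDiff ℝ ∞ (deriv g) := (contDiff_infty_iff_deriv.1 hg).2
      refine ⟨fun η => b * deriv g η + (c - k) * g η,
        (contDiff_const.mul hg').add (contDiff_const.mul hg), fun m => ?_, fun s hs => ?_⟩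
      · obtain ⟨C₁, hC₁⟩ := hgb (m + 1)
        obtain ⟨C₀, hC₀⟩ := hgb m
        refine ⟨|b| * C₁ + |c - (k : ℝ)| * C₀, fun η hη => ?_⟩
        have e1 : iteratedDeriv m (fun η => b * deriv g η + (c - k) * g η) η =
            b * iteratedDeriv (m + 1) g η + (c - k) * iteratedDeriv m g η := by
          have ha : ContDiffAt ℝ m (fun η => b * deriv g η) η :=
            ((contDiff_const.mul hg').of_le (by exact_mod_cast le_top)).contDiffAt
          have hb' : ContDiffAt ℝ m (fun η => (c - (k : ℝ)) * g η) η :=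
            ((contDiff_const.mul hg).of_le (by exact_mod_cast le_top)).contDiffAt
          have := iteratedDeriv_add ha hb'
          rw [show ((fun η => b * deriv g η) + fun η => (c - (k : ℝ)) * g η) =
            fun η => b * deriv g η + (c - k) * g η from rfl] at this
          rw [this, iteratedDeriv_const_mul _ ((hg'.of_le (by exact_mod_cast le_top)).contDiffAt),
            iteratedDeriv_const_mul _ ((hg.of_le (by exact_mod_cast le_top)).contDiffAt),
            ← iteratedDeriv_succ']
        rw [e1]
        calc |b * iteratedDeriv (m + 1) g η + (c - ↑k) * iteratedDeriv m g η|
            ≤ |b * iteratedDeriv (m + 1) g η| + |(c - ↑k) * iteratedDeriv m g η| := abs_add_le _ _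
          _ ≤ |b| * C₁ + |c - (k : ℝ)| * C₀ := by
            rw [abs_mul, abs_mul]
            exact add_le_add (mul_le_mul_of_nonneg_left (hC₁ η hη) (abs_nonneg _))
              (mul_le_mul_of_nonneg_left (hC₀ η hη) (abs_nonneg _))
      · have hs0 : 0 < s := hs₀.trans hs
        have heq : iteratedDeriv k Ψ =ᶠ[𝓝 s] fun σ => σ ^ (c - k) * g (b * Real.log σ) := by
          filter_upwards [Ioi_mem_nhds hs] with σ hσ
          exact hfo σ hσ
        have d1 : HasDerivAt (fun σ => σ ^ (c - (k : ℝ)))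
            ((c - (k : ℝ)) * s ^ (c - (k : ℝ) - 1)) s := by
          simpa using Real.hasDerivAt_rpow_const (p := c - (k : ℝ)) (Or.inl hs0.ne')
        have d2 : HasDerivAt (fun σ => g (b * Real.log σ)) (deriv g (b * Real.log s) * (b * s⁻¹)) s :=
          ((hg.differentiable (by simp) _).hasDerivAt).comp s
            ((Real.hasDerivAt_log hs0.ne').const_mul b)
        have d3 : HasDerivAt (fun σ => σ ^ (c - (k : ℝ)) * g (b * Real.log σ))
            ((c - (k : ℝ)) * s ^ (c - (k : ℝ) - 1) * g (b * Real.log s) +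
              s ^ (c - (k : ℝ)) * (deriv g (b * Real.log s) * (b * s⁻¹))) s := d1.mul d2
        rw [iteratedDeriv_succ, heq.deriv_eq, d3.deriv]
        have e2 : s ^ (c - (k : ℝ)) = s ^ (c - (k : ℝ) - 1) * s := by
          rw [Real.rpow_sub_one hs0.ne']
          field_simp
        rw [show (c - ((k + 1 : ℕ) : ℝ)) = c - (k : ℝ) - 1 by push_cast; ring, e2]
        field_simp
        ring
  obtain ⟨g, -, hgb, hfo⟩ := key k
  obtain ⟨C, hC⟩ := hgb 0
  refine ⟨C, fun s hs => ?_⟩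
  have hs0 : 0 < s := hs₀.trans hs
  rw [hfo s hs, abs_mul, abs_of_pos (Real.rpow_pos_of_pos hs0 _), mul_comm]
  exact mul_le_mul_of_nonneg_right (by simpa using hC _ (hlog s hs)) (Real.rpow_nonneg hs0.le _)

end RpowLog

/-! ### The profile through `s = |y|²`: `s ↦ S(√s)` and `s ↦ U(√s)/√s` -/

section Sqrt

variable {r : ℝ} {U S : ℝ → ℝ}

/-- **Derivative bounds for `S(√s)` and `U(√s)/√s`.** With `𝒮(ξ) = S(e^ξ)/e^ξ`,
`𝒰(ξ) = U(e^ξ)/e^ξ`: `S(√s) = s^{1/2} 𝒮(½ log s)` and `U(√s)/√s = 𝒰(½ log s)`, so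
`iteratedDeriv_le_of_rpow_mul_log` and `exists_bound_iteratedDeriv_logProfile` give, for some
`s₀ ≥ 1`, smoothness on `(s₀, ∞)` and `|dᵏ/dsᵏ S(√s)| ≤ C s^{1/2−k}`,
`|dᵏ/dsᵏ (U(√s)/√s)| ≤ C s^{−k}` for `s > s₀`.
[cite: CaolaboraEtAl2025, eq. (1.6) p. 6] -/
theorem iteratedDeriv_profile_sqrt_le
    (hU : ContDiff ℝ ∞ fun y : V3 => (U ‖y‖ / ‖y‖) • y) (hS : ContDiff ℝ ∞ fun y : V3 => S ‖y‖)
    (hode : ∀ ζ : ℝ, 0 < ζ →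
      (r - 1) * U ζ + (ζ + U ζ) * deriv U ζ + 1 / 3 * S ζ * deriv S ζ = 0 ∧
      (r - 1) * S ζ + (ζ + U ζ) * deriv S ζ + 1 / 3 * S ζ * (deriv U ζ + 2 * U ζ / ζ) = 0)
    (hlimU : Tendsto (fun ζ => U ζ / ζ) atTop (𝓝 0))
    (hlimS : Tendsto (fun ζ => S ζ / ζ) atTop (𝓝 0)) :
    ∃ s₀ : ℝ, 1 ≤ s₀ ∧
      (∀ s, s₀ < s → ContDiffAt ℝ ∞ (fun s => S (Real.sqrt s)) s) ∧
      (∀ s, s₀ < s → ContDiffAt ℝ ∞ (fun s => U (Real.sqrt s) / Real.sqrt s) s) ∧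
      (∀ k : ℕ, ∃ C, ∀ s, s₀ < s →
        |iteratedDeriv k (fun s => S (Real.sqrt s)) s| ≤ C * s ^ (1 / 2 - (k : ℝ))) ∧
      (∀ k : ℕ, ∃ C, ∀ s, s₀ < s →
        |iteratedDeriv k (fun s => U (Real.sqrt s) / Real.sqrt s) s| ≤ C * s ^ (0 - (k : ℝ))) := by
  have hUc : ∀ ζ : ℝ, 0 < ζ → ContDiffAt ℝ ∞ U ζ := fun ζ hζ => contDiffAt_profile_of_radialField hU hζ
  have hSc : ∀ ζ : ℝ, 0 < ζ → ContDiffAt ℝ ∞ S ζ := fun ζ hζ => contDiffAt_profile_of_radialScalar hS hζ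
  obtain ⟨a, ha⟩ := exists_bound_iteratedDeriv_logProfile hU hS hode hlimU hlimS
  -- threshold: `s₀ = max 1 (e^{2a})`, so that `½ log s > a` for `s > s₀`
  set s₀ : ℝ := max 1 (Real.exp (2 * a)) with hs₀
  have hs₀1 : 1 ≤ s₀ := le_max_left _ _
  have hs₀0 : 0 < s₀ := one_pos.trans_le hs₀1
  have has : a ≤ 1 / 2 * Real.log s₀ := by
    have h1 : Real.exp (2 * a) ≤ s₀ := le_max_right _ _
    have h2 : 2 * a ≤ Real.log s₀ := by
      rw [← Real.log_exp (2 * a)]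
      exact Real.log_le_log (Real.exp_pos _) h1
    linarith
  -- smoothness for `s > 0`
  have hSq : ∀ s, 0 < s → ContDiffAt ℝ ∞ (fun s => S (Real.sqrt s)) s := fun s hs =>
    (hSc _ (Real.sqrt_pos.2 hs)).comp s (Real.contDiffAt_sqrt hs.ne')
  have hUq : ∀ s, 0 < s → ContDiffAt ℝ ∞ (fun s => U (Real.sqrt s) / Real.sqrt s) s := fun s hs =>
    ((hUc _ (Real.sqrt_pos.2 hs)).comp s (Real.contDiffAt_sqrt hs.ne')).div
      (Real.contDiffAt_sqrt hs.ne') (Real.sqrt_pos.2 hs).ne'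
  -- the factorizations through the logarithmic variable
  have hlog2 : ∀ s, 0 < s → Real.exp (1 / 2 * Real.log s) = Real.sqrt s := fun s hs => by
    rw [Real.sqrt_eq_rpow, Real.rpow_def_of_pos hs]
    ring_nf
  have hfS : ∀ s, s₀ < s → S (Real.sqrt s) =
      s ^ (1 / 2 : ℝ) * (Real.exp (-(1 / 2 * Real.log s)) * S (Real.exp (1 / 2 * Real.log s))) := by
    intro s hs
    have hs0 : 0 < s := hs₀0.trans hs
    rw [hlog2 s hs0, Real.exp_neg, hlog2 s hs0, ← Real.sqrt_eq_rpow]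
    field_simp [(Real.sqrt_pos.2 hs0).ne']
  have hfU : ∀ s, s₀ < s → U (Real.sqrt s) / Real.sqrt s =
      s ^ (0 : ℝ) * (Real.exp (-(1 / 2 * Real.log s)) * U (Real.exp (1 / 2 * Real.log s))) := by
    intro s hs
    have hs0 : 0 < s := hs₀0.trans hs
    rw [hlog2 s hs0, Real.exp_neg, hlog2 s hs0, Real.rpow_zero]
    field_simp [(Real.sqrt_pos.2 hs0).ne']
  refine ⟨s₀, hs₀1, fun s hs => hSq s (hs₀0.trans hs), fun s hs => hUq s (hs₀0.trans hs),
    fun k => ?_, fun k => ?_⟩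
  · exact iteratedDeriv_le_of_rpow_mul_log (by norm_num) (contDiff_logProfile hSc)
      (fun m => (ha m).imp fun C hC η hη => (hC η hη).2) hs₀0 has hfS k
  · exact iteratedDeriv_le_of_rpow_mul_log (by norm_num) (contDiff_logProfile hUc)
      (fun m => (ha m).imp fun C hC η hη => (hC η hη).1) hs₀0 has hfU k

end Sqrt

/-! ### From one-variable bounds on a half-line to temperate growth -/

section Temperate

/-- One-variable bounds `|g^{(k)}(s)| ≤ C_k s^{c−k}` for `s > s₀ ≥ 1` (with `g` smooth there)
are the hypothesis of `Function.HasTemperateGrowth.comp'` on the open half-line `(s₀, ∞)`.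
[folklore] -/
theorem temperate_hyp_of_iteratedDeriv_le {g : ℝ → ℝ} {s₀ c : ℝ} (hs₀ : 1 ≤ s₀)
    (hg : ∀ s, s₀ < s → ContDiffAt ℝ ∞ g s)
    (hb : ∀ k : ℕ, ∃ C, ∀ s, s₀ < s → |iteratedDeriv k g s| ≤ C * s ^ (c - k)) :
    ∀ N : ℕ, ∃ (k : ℕ) (C : ℝ) (_ : 0 ≤ C), ∀ n ≤ N, ∀ x ∈ Ioi s₀,
      ‖iteratedFDerivWithin ℝ n g (Ioi s₀) x‖ ≤ C * (1 + ‖x‖) ^ k := by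
  choose C hC using hb
  intro N
  obtain ⟨k, hk⟩ := exists_nat_ge c
  refine ⟨k, ∑ i ∈ Finset.range (N + 1), max (C i) 0, Finset.sum_nonneg fun i _ => le_max_right _ _,
    fun n hn x hx => ?_⟩
  have hx1 : 1 ≤ x := hs₀.trans (le_of_lt hx)
  have hx0 : 0 < x := one_pos.trans_le hx1
  rw [norm_iteratedFDerivWithin_eq_norm_iteratedDerivWithin,
    iteratedDerivWithin_eq_iteratedDeriv (isOpen_Ioi.uniqueDiffOn)
      ((hg x hx).of_le (by exact_mod_cast le_top)) hx, Real.norm_eq_abs]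
  have h1 : |iteratedDeriv n g x| ≤ max (C n) 0 * (1 + ‖x‖) ^ k := by
    refine (hC n x hx).trans ?_
    have hpow : x ^ (c - n) ≤ (1 + ‖x‖) ^ k := by
      calc x ^ (c - n) ≤ x ^ (k : ℝ) :=
            Real.rpow_le_rpow_of_exponent_le hx1 ((sub_le_self c (Nat.cast_nonneg n)).trans hk)
        _ = x ^ k := Real.rpow_natCast x k
        _ ≤ (1 + ‖x‖) ^ k := by
            refine pow_le_pow_left₀ hx0.le ?_ k
            rw [Real.norm_eq_abs, abs_of_pos hx0]
            linarith
    calc C n * x ^ (c - n) ≤ max (C n) 0 * x ^ (c - n) :=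
          mul_le_mul_of_nonneg_right (le_max_left _ _) (Real.rpow_nonneg hx0.le _)
      _ ≤ max (C n) 0 * (1 + ‖x‖) ^ k := mul_le_mul_of_nonneg_left hpow (le_max_right _ _)
  refine h1.trans (mul_le_mul_of_nonneg_right ?_ (by positivity))
  exact Finset.single_le_sum (f := fun i => max (C i) 0) (fun i _ => le_max_right _ _)
    (Finset.mem_range.2 (Nat.lt_succ_of_le hn))

/-- A smooth function on a half-line `(s₀, ∞)`, `s₀ ≥ 1`, with derivative bounds
`|g^{(k)}(s)| ≤ C_k s^{c−k}`, composed with a temperate map into that half-line, has temperate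
growth. [folklore] -/
theorem hasTemperateGrowth_comp_of_iteratedDeriv_le {E : Type*} [NormedAddCommGroup E]
    [NormedSpace ℝ E] {g : ℝ → ℝ} {f : E → ℝ} {s₀ c : ℝ} (hs₀ : 1 ≤ s₀)
    (hg : ∀ s, s₀ < s → ContDiffAt ℝ ∞ g s)
    (hb : ∀ k : ℕ, ∃ C, ∀ s, s₀ < s → |iteratedDeriv k g s| ≤ C * s ^ (c - k))
    (hf : f.HasTemperateGrowth) (hrange : ∀ x, s₀ < f x) :
    (g ∘ f).HasTemperateGrowth :=
  hf.comp' (t := Ioi s₀) (by rintro - ⟨x, rfl⟩; exact hrange x) isOpen_Ioi.uniqueDiffOn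
    (fun s hs => (hg s hs).contDiffWithinAt) (temperate_hyp_of_iteratedDeriv_le hs₀ hg hb)

end Temperate

/-! ### The profile fields have temperate growth -/

section Fields

variable {r : ℝ} {U S : ℝ → ℝ}

/-- **The rescaled sound-speed profile `S̄(y) = S(|y|)` has temperate growth on `ℝ³`** (smooth,
all derivatives polynomially bounded): the field form of the far-field asymptotics (1.6) of the
source, in the weak form that follows from the hypotheses of the vendored profile fact.
[cite: CaolaboraEtAl2025, eq. (1.6) p. 6] [cite: BuckmasterCaolaboraGomezserrano2025, Thm 1.1 p. 4] -/
theorem hasTemperateGrowth_radialScalar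
    (hU : ContDiff ℝ ∞ fun y : V3 => (U ‖y‖ / ‖y‖) • y) (hS : ContDiff ℝ ∞ fun y : V3 => S ‖y‖)
    (hode : ∀ ζ : ℝ, 0 < ζ →
      (r - 1) * U ζ + (ζ + U ζ) * deriv U ζ + 1 / 3 * S ζ * deriv S ζ = 0 ∧
      (r - 1) * S ζ + (ζ + U ζ) * deriv S ζ + 1 / 3 * S ζ * (deriv U ζ + 2 * U ζ / ζ) = 0)
    (hlimU : Tendsto (fun ζ => U ζ / ζ) atTop (𝓝 0))
    (hlimS : Tendsto (fun ζ => S ζ / ζ) atTop (𝓝 0)) :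
    (fun y : V3 => S ‖y‖).HasTemperateGrowth := by
  obtain ⟨s₀, hs₀1, hSq, -, hSb, -⟩ := iteratedDeriv_profile_sqrt_le hU hS hode hlimU hlimS
  have hs₀0 : 0 < s₀ := one_pos.trans_le hs₀1
  -- radii and bumps
  set R : ℝ := Real.sqrt (s₀ + 1) with hR
  have hR0 : 0 < R := Real.sqrt_pos.2 (by linarith)
  let χ₂ : ContDiffBump (0 : V3) := ⟨R, R + 1, hR0, by linarith⟩
  let χ₁ : ContDiffBump (0 : V3) := ⟨R + 1, R + 2, by linarith, by linarith⟩
  -- the temperate radius-squared, pushed above `s₀`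
  set f : V3 → ℝ := fun y => ‖y‖ ^ 2 + (s₀ + 1) * χ₂ y with hf
  have hft : f.HasTemperateGrowth := by
    have h1 : (fun y : V3 => ‖y‖ ^ 2).HasTemperateGrowth := Function.hasTemperateGrowth_norm_sq V3
    have h2 : (fun y : V3 => (s₀ + 1) * χ₂ y).HasTemperateGrowth :=
      (Function.HasTemperateGrowth.const (s₀ + 1)).mul
        (χ₂.hasCompactSupport.hasTemperateGrowth χ₂.contDiff)
    exact h1.add h2
  have hrange : ∀ y, s₀ < f y := by
    intro y
    simp only [hf]
    by_cases hy : ‖y‖ ≤ R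
    · have : χ₂ y = 1 := χ₂.one_of_mem_closedBall (by simpa using hy)
      rw [this]
      nlinarith [sq_nonneg ‖y‖]
    · push Not at hy
      have h1 : s₀ + 1 < ‖y‖ ^ 2 := by
        calc s₀ + 1 = R ^ 2 := (Real.sq_sqrt (by linarith)).symm
          _ < ‖y‖ ^ 2 := by gcongr
      nlinarith [χ₂.nonneg (x := y)]
  -- the far piece
  have hfar : ((fun s => S (Real.sqrt s)) ∘ f).HasTemperateGrowth :=
    hasTemperateGrowth_comp_of_iteratedDeriv_le hs₀1 hSq hSb hft hrange
  -- the decomposition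
  have hdec : (fun y : V3 => S ‖y‖) =
      (fun y => χ₁ y * S ‖y‖) + fun y => (1 - χ₁ y) * ((fun s => S (Real.sqrt s)) ∘ f) y := by
    funext y
    simp only [Pi.add_apply, Function.comp_apply]
    by_cases hy : ‖y‖ ≤ R + 1
    · have : χ₁ y = 1 := χ₁.one_of_mem_closedBall (by simpa using hy)
      rw [this]
      ring
    · push Not at hy
      have h2 : χ₂ y = 0 := χ₂.zero_of_le_dist (by simpa using hy.le)
      have hfy : f y = ‖y‖ ^ 2 := by simp [hf, h2]
      rw [hfy, Real.sqrt_sq (norm_nonneg y)]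
      ring
  rw [hdec]
  refine Function.HasTemperateGrowth.add ?_ ?_
  · exact (χ₁.hasCompactSupport.mul_right).hasTemperateGrowth (χ₁.contDiff.mul hS)
  · have h1 : (fun y : V3 => 1 - χ₁ y).HasTemperateGrowth := by
      have := (Function.HasTemperateGrowth.const (1 : ℝ)).sub
        (χ₁.hasCompactSupport.hasTemperateGrowth χ₁.contDiff)
      exact this
    exact h1.mul hfar

/-- **The velocity profile `Ū(y) = U(|y|) y/|y|` has temperate growth on `ℝ³`.**
[cite: CaolaboraEtAl2025, eq. (1.6) p. 6] [cite: BuckmasterCaolaboraGomezserrano2025, Thm 1.1 p. 4] -/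
theorem hasTemperateGrowth_radialField
    (hU : ContDiff ℝ ∞ fun y : V3 => (U ‖y‖ / ‖y‖) • y) (hS : ContDiff ℝ ∞ fun y : V3 => S ‖y‖)
    (hode : ∀ ζ : ℝ, 0 < ζ →
      (r - 1) * U ζ + (ζ + U ζ) * deriv U ζ + 1 / 3 * S ζ * deriv S ζ = 0 ∧
      (r - 1) * S ζ + (ζ + U ζ) * deriv S ζ + 1 / 3 * S ζ * (deriv U ζ + 2 * U ζ / ζ) = 0)
    (hlimU : Tendsto (fun ζ => U ζ / ζ) atTop (𝓝 0))
    (hlimS : Tendsto (fun ζ => S ζ / ζ) atTop (𝓝 0)) :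
    (fun y : V3 => (U ‖y‖ / ‖y‖) • y).HasTemperateGrowth := by
  obtain ⟨s₀, hs₀1, -, hUq, -, hUb⟩ := iteratedDeriv_profile_sqrt_le hU hS hode hlimU hlimS
  have hs₀0 : 0 < s₀ := one_pos.trans_le hs₀1
  set R : ℝ := Real.sqrt (s₀ + 1) with hR
  have hR0 : 0 < R := Real.sqrt_pos.2 (by linarith)
  let χ₂ : ContDiffBump (0 : V3) := ⟨R, R + 1, hR0, by linarith⟩
  let χ₁ : ContDiffBump (0 : V3) := ⟨R + 1, R + 2, by linarith, by linarith⟩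
  set f : V3 → ℝ := fun y => ‖y‖ ^ 2 + (s₀ + 1) * χ₂ y with hf
  have hft : f.HasTemperateGrowth := by
    have h1 : (fun y : V3 => ‖y‖ ^ 2).HasTemperateGrowth := Function.hasTemperateGrowth_norm_sq V3
    have h2 : (fun y : V3 => (s₀ + 1) * χ₂ y).HasTemperateGrowth :=
      (Function.HasTemperateGrowth.const (s₀ + 1)).mul
        (χ₂.hasCompactSupport.hasTemperateGrowth χ₂.contDiff)
    exact h1.add h2
  have hrange : ∀ y, s₀ < f y := by
    intro y
    simp only [hf]
    by_cases hy : ‖y‖ ≤ R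
    · have : χ₂ y = 1 := χ₂.one_of_mem_closedBall (by simpa using hy)
      rw [this]
      nlinarith [sq_nonneg ‖y‖]
    · push Not at hy
      have h1 : s₀ + 1 < ‖y‖ ^ 2 := by
        calc s₀ + 1 = R ^ 2 := (Real.sq_sqrt (by linarith)).symm
          _ < ‖y‖ ^ 2 := by gcongr
      nlinarith [χ₂.nonneg (x := y)]
  have hfar : ((fun s => U (Real.sqrt s) / Real.sqrt s) ∘ f).HasTemperateGrowth :=
    hasTemperateGrowth_comp_of_iteratedDeriv_le hs₀1 hUq hUb hft hrange
  have hdec : (fun y : V3 => (U ‖y‖ / ‖y‖) • y) =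
      (fun y => χ₁ y • ((U ‖y‖ / ‖y‖) • y)) +
        fun y => ((1 - χ₁ y) * ((fun s => U (Real.sqrt s) / Real.sqrt s) ∘ f) y) • y := by
    funext y
    simp only [Pi.add_apply, Function.comp_apply]
    by_cases hy : ‖y‖ ≤ R + 1
    · have : χ₁ y = 1 := χ₁.one_of_mem_closedBall (by simpa using hy)
      rw [this]
      simp
    · push Not at hy
      have h2 : χ₂ y = 0 := χ₂.zero_of_le_dist (by simpa using hy.le)
      have hfy : f y = ‖y‖ ^ 2 := by simp [hf, h2]
      rw [hfy, Real.sqrt_sq (norm_nonneg y), smul_smul, ← add_smul]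
      congr 1
      ring
  rw [hdec]
  refine Function.HasTemperateGrowth.add ?_ ?_
  · exact (χ₁.hasCompactSupport.smul_right).hasTemperateGrowth (χ₁.contDiff.smul hU)
  · have h1 : (fun y : V3 => 1 - χ₁ y).HasTemperateGrowth :=
      (Function.HasTemperateGrowth.const (1 : ℝ)).sub
        (χ₁.hasCompactSupport.hasTemperateGrowth χ₁.contDiff)
    exact (h1.mul hfar).smul Function.HasTemperateGrowth.id'

end Fields

end CaolaboraEtAl2025

end Literature.Analysis.FluidPDE
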